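import Summits.KontsevichZagierPeriods.KontsevichZagierPeriods.Theses.HermiteRigidity
import Summits.KontsevichZagierPeriods.KontsevichZagierPeriods.Theorems.HermiteRigidityGenusTwoCycleTransferPushforwardDimOne
import Summits.KontsevichZagierPeriods.KontsevichZagierPeriods.Theorems.HermiteRigidityCMTwistPeriodTransferAlgebra
import Literature.NumberTheory.Transcendental.KZLogCalculusProofs
import Literature.NumberTheory.Transcendental.SemialgebraicLineDeriv

/-!
# `CMTwistPeriodTransfer` (stmt-KontsevichZagierPeriods-3415, route HermiteRigidity)

Closing file. On `y² = f(x) = 4x³ − 120x + 224` (`j = 8000`, CM by `ℤ[√−2]`) the CM period relation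
`∫_{e₂}^{4} dx/√(−f) = (1/√2)∫_{e₃}^{e₂} dx/√f` is DERIVED inside the Kontsevich–Zagier move
calculus (`KZ.Equivalent`): the `x`-coordinate `Ψ(x) = −x/2 − 9/(x − 4)` of `[√−2]` is a real
rational map with `f(Ψ x) = −f(x)Ψ′(x)²/2`, folding the bounded oval `σ = (e₃, e₂)` at
`x₀ = 4 − √18` onto the twisted oval `σ' = (e₂, 4)`. The chain of moves, for representations
`r = [σ', 1/√(−f)]` and `r' = [σ, 1/(√2√f)]`:

* rule (1a) twice: `[σ] = [(e₃, x₀]] + [(x₀, e₂)]`, `[(e₃, x₀]] = [(e₃, x₀)] + [{x₀}]`, and the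
  point representation is a relation (null domain, `KZ.of_mem_relations_of_volume_eq_zero`);
* rule (2) twice: `[(e₃, x₀), 1/(√2√f)] ∼ [σ', h/2]` and `[(x₀, e₂), 1/(√2√f)] ∼ [σ', h/2]` along
  `Ψ` (injective on each half, onto `σ'`, Jacobian weight `|Ψ′|/√(−f∘Ψ) = √2/√f`), where
  `h = r.integrand`;
* rule (1b) once: `[σ', h] = [σ', h/2] + [σ', h/2]`.

All pieces are typed by `ℚ`-polynomial (in)equalities in `x` (the fold point is `(x − 4)² = 18`),
so every domain is `ℚ`-semialgebraic without Tarski–Seidenberg input beyond the tree's API. The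
real algebra (signs, `Ψ`'s injectivity/surjectivity on the halves, the weight) is in
`HermiteRigidityCMTwistPeriodTransferAlgebra.lean`; the `ℝ¹` plumbing (`det (c • id) = c`, chain
rule for `p ↦ (φ (p 0))`) is reused from `HermiteRigidityGenusTwoCycleTransferPushforwardDimOne`.

`CMTwistPeriodTransfer_proof` concludes the route declaration
`Summit.KontsevichZagierPeriods.KontsevichZagierPeriods.Theses.HermiteRigidity.CMTwistPeriodTransfer`
by name.

References: M. Kontsevich, D. Zagier, *Periods* (2001), §1.2 rules (1), (2); J. H. Silverman,
*Advanced Topics in the Arithmetic of Elliptic Curves* (1994), Prop. II.2.3.1; J. Bochnak,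
M. Coste, M.-F. Roy, *Real Algebraic Geometry* (1998), §2.2.
-/

noncomputable section

open Set MeasureTheory MvPolynomial
open Literature.NumberTheory.Transcendental Literature.ModelTheory.ExponentialFields
open Summit.KontsevichZagierPeriods.HermiteRigidity.GenusTwoCycleTransfer
  (det_smul_id_fin_one hasFDerivAt_fin_one)

namespace Summit.KontsevichZagierPeriods.HermiteRigidity.CMTwistPeriodTransfer

/-! ### Semialgebraic pieces of `ℝ¹` -/

/-- `{p | 18 < (p 0 − 4)²}` is `ℚ`-semialgebraic. [cite: BochnakCosteRoy1998, §2.1] -/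
theorem isSemialgebraic_setOf_lt_sq :
    IsSemialgebraic ℚ {p : Fin 1 → ℝ | 18 < (p 0 - 4) ^ 2} := by
  have h : {p : Fin 1 → ℝ | 18 < (p 0 - 4) ^ 2} =
      {p | aeval p (18 : MvPolynomial (Fin 1) ℚ) < aeval p ((X 0 - 4) ^ 2 : MvPolynomial (Fin 1) ℚ)} := by
    ext p
    simp only [mem_setOf_eq, map_pow, map_sub, aeval_X, map_ofNat]
  rw [h]
  exact isSemialgebraic_setOf_eval_lt _ _

/-- `{p | 18 ≤ (p 0 − 4)²}` is `ℚ`-semialgebraic. [cite: BochnakCosteRoy1998, §2.1] -/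
theorem isSemialgebraic_setOf_le_sq :
    IsSemialgebraic ℚ {p : Fin 1 → ℝ | 18 ≤ (p 0 - 4) ^ 2} := by
  have h : {p : Fin 1 → ℝ | 18 ≤ (p 0 - 4) ^ 2} =
      {p | aeval p (18 : MvPolynomial (Fin 1) ℚ) ≤ aeval p ((X 0 - 4) ^ 2 : MvPolynomial (Fin 1) ℚ)} := by
    ext p
    simp only [mem_setOf_eq, map_pow, map_sub, aeval_X, map_ofNat]
  rw [h]
  exact isSemialgebraic_setOf_eval_le _ _

/-- `{p | (p 0 − 4)² < 18}` is `ℚ`-semialgebraic. [cite: BochnakCosteRoy1998, §2.1] -/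
theorem isSemialgebraic_setOf_sq_lt :
    IsSemialgebraic ℚ {p : Fin 1 → ℝ | (p 0 - 4) ^ 2 < 18} := by
  have h : {p : Fin 1 → ℝ | (p 0 - 4) ^ 2 < 18} =
      {p | aeval p ((X 0 - 4) ^ 2 : MvPolynomial (Fin 1) ℚ) < aeval p (18 : MvPolynomial (Fin 1) ℚ)} := by
    ext p
    simp only [mem_setOf_eq, map_pow, map_sub, aeval_X, map_ofNat]
  rw [h]
  exact isSemialgebraic_setOf_eval_lt _ _

/-- `{p | (p 0 − 4)² = 18}` is `ℚ`-semialgebraic. [cite: BochnakCosteRoy1998, §2.1] -/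
theorem isSemialgebraic_setOf_sq_eq :
    IsSemialgebraic ℚ {p : Fin 1 → ℝ | (p 0 - 4) ^ 2 = 18} := by
  have h : {p : Fin 1 → ℝ | (p 0 - 4) ^ 2 = 18} =
      {p | aeval p ((X 0 - 4) ^ 2 - 18 : MvPolynomial (Fin 1) ℚ) = 0} := by
    ext p
    simp only [mem_setOf_eq, map_pow, map_sub, aeval_X, map_ofNat, sub_eq_zero]
  rw [h]
  exact isSemialgebraic_setOf_eval_eq_zero _

/-- The fold locus `{p | (p 0 − 4)² = 18}` (two points of `ℝ¹`) is Lebesgue-null. [folklore] -/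
theorem volume_setOf_sq_eq : volume {p : Fin 1 → ℝ | (p 0 - 4) ^ 2 = 18} = 0 := by
  have h1 := KZ.volume_setOf_last_eq_zero (n := 0) (4 + Real.sqrt 18)
  have h2 := KZ.volume_setOf_last_eq_zero (n := 0) (4 - Real.sqrt 18)
  refine measure_mono_null (fun p hp => ?_) (measure_union_null h1 h2)
  have hp' : (p 0 - 4) ^ 2 = Real.sqrt 18 ^ 2 := by rw [sq_sqrt18]; exact hp
  have h0 : (Fin.last 0 : Fin 1) = 0 := rfl
  simp only [mem_union, mem_setOf_eq, h0]
  rcases sq_eq_sq_iff_eq_or_eq_neg.mp hp' with h | h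
  · left; linarith
  · right; linarith

/-- `p ↦ Ψ(p 0) = −(p 0)/2 − 9/(p 0 − 4)` is a `ℚ`-semialgebraic function on any `ℚ`-semialgebraic
set avoiding the pole (a quotient of `ℚ`-polynomials). [cite: BochnakCosteRoy1998, §2.2] -/
theorem psi_semialgebraic {T : Set (Fin 1 → ℝ)} (hT : IsSemialgebraic ℚ T)
    (h4 : ∀ p ∈ T, p 0 ≠ 4) :
    IsSemialgebraicFunOn ℚ T (fun p => -(p 0) / 2 - 9 / (p 0 - 4)) := by
  have h1 := isSemialgebraicFunOn_aeval_div_aeval hT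
    (-(X 0) * (X 0 - 4) - 18 : MvPolynomial (Fin 1) ℚ) (2 * (X 0 - 4))
    (fun p hp => by
      simp only [map_mul, map_sub, aeval_X, map_ofNat]
      exact mul_ne_zero two_ne_zero (sub_ne_zero.mpr (h4 p hp)))
  refine h1.congr fun p hp => ?_
  have h4' : p 0 - 4 ≠ 0 := sub_ne_zero.mpr (h4 p hp)
  simp only [map_mul, map_sub, map_neg, aeval_X, map_ofNat]
  field_simp
  ring

/-! ### The half representation `[σ', h/2]` (rule 1b) -/

/-- For every representation `r` there is `s = [r.domain, r.integrand/2]` with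
`[r] − [s] − [s] ∈ KZ.integrandAddRel`. [cite: KontsevichZagier2001, §1.2 rule (1)] -/
theorem exists_half (r : KZ.IntegralRep 1) :
    ∃ s : KZ.IntegralRep 1, s.domain = r.domain ∧ (s.integrand = fun p => r.integrand p / 2) ∧
      KZ.of r - KZ.of s - KZ.of s ∈ KZ.integrandAddRel := by
  have hσ : IsSemialgebraic ℚ r.domain := r.isSemialgebraic_domain
  have hsa : IsSemialgebraicFunOn ℚ r.domain (fun p => r.integrand p / 2) :=
    (r.isSemialgebraicFunOn_integrand.fun_mul (isSemialgebraicFunOn_const_ofNat hσ 2).fun_inv).congr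
      fun p _ => (div_eq_mul_inv (r.integrand p) 2).symm
  have hint : IntegrableOn (fun p => r.integrand p / 2) r.domain :=
    MeasureTheory.Integrable.div_const r.integrableOn 2
  set s : KZ.IntegralRep 1 := ⟨r.domain, fun p => r.integrand p / 2, hσ, hsa, hint⟩ with hs_def
  refine ⟨s, rfl, rfl, ?_⟩
  refine ⟨1, r, s, s, rfl, rfl, fun p _ => ?_, rfl⟩
  show r.integrand p = r.integrand p / 2 + r.integrand p / 2
  ring

/-! ### One rule-2 move along `Ψ` on a half of the bounded oval -/

/-- **Rule 2 along `Ψ` on a piece.** Let `r = [σ', h]` with `h = 1/√(−f)` on `σ'`, `r' = [σ, g]`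
with `g = 1/(√2√f)` on `σ`, and `s = [σ', h/2]`. If `T ⊆ σ` is `ℚ`-semialgebraic, avoids the fold
locus, and `Φ : p ↦ (Ψ (p 0))` is injective on `T` with `Φ T = σ'`, then
`[r'|T] − [s] ∈ KZ.changeOfVariablesRel` (Jacobian weight `weight`).
[cite: KontsevichZagier2001, §1.2 rule (2)] -/
theorem piece_cov (r r' s : KZ.IntegralRep 1)
    (hd : r.domain = {p | 4 * p 0 ^ 3 - 120 * p 0 + 224 < 0 ∧ 0 < p 0})
    (hi : EqOn r.integrand (fun p => 1 / Real.sqrt (-(4 * p 0 ^ 3 - 120 * p 0 + 224)))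
      {p | 4 * p 0 ^ 3 - 120 * p 0 + 224 < 0 ∧ 0 < p 0})
    (hd' : r'.domain = {p | 0 < 4 * p 0 ^ 3 - 120 * p 0 + 224 ∧ p 0 < 4})
    (hi' : EqOn r'.integrand
      (fun p => 1 / (Real.sqrt 2 * Real.sqrt (4 * p 0 ^ 3 - 120 * p 0 + 224)))
      {p | 0 < 4 * p 0 ^ 3 - 120 * p 0 + 224 ∧ p 0 < 4})
    (hsd : s.domain = r.domain) (hsi : s.integrand = fun p => r.integrand p / 2)
    {T : Set (Fin 1 → ℝ)} (hT : IsSemialgebraic ℚ T) (hTσ : T ⊆ r'.domain)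
    (h18 : ∀ p ∈ T, (p 0 - 4) ^ 2 ≠ 18)
    (hinj : InjOn (fun p : Fin 1 → ℝ => fun _ : Fin 1 => -(p 0) / 2 - 9 / (p 0 - 4)) T)
    (himg : (fun p : Fin 1 → ℝ => fun _ : Fin 1 => -(p 0) / 2 - 9 / (p 0 - 4)) '' T = r.domain) :
    KZ.of (r'.restrict T hT hTσ) - KZ.of s ∈ KZ.changeOfVariablesRel := by
  set Φ : (Fin 1 → ℝ) → (Fin 1 → ℝ) := fun p _ => -(p 0) / 2 - 9 / (p 0 - 4) with hΦ_def
  set Φ' : (Fin 1 → ℝ) → ((Fin 1 → ℝ) →L[ℝ] (Fin 1 → ℝ)) :=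
    fun p => (-1 / 2 + 9 / (p 0 - 4) ^ 2) • ContinuousLinearMap.id ℝ (Fin 1 → ℝ) with hΦ'_def
  have hmemσ : ∀ p ∈ T, 0 < 4 * p 0 ^ 3 - 120 * p 0 + 224 ∧ p 0 < 4 := fun p hp => by
    have := hTσ hp
    rw [hd'] at this
    exact this
  have hx4 : ∀ p ∈ T, p 0 ≠ 4 := fun p hp => ne_of_lt (hmemσ p hp).2
  have hΦsa : IsSemialgebraicMapOn ℚ T Φ :=
    IsSemialgebraicMapOn.of_forall hT fun _ => psi_semialgebraic hT hx4
  have hderiv : ∀ p ∈ T, HasFDerivWithinAt Φ (Φ' p) T p := fun p hp =>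
    (hasFDerivAt_fin_one (fun y : ℝ => -y / 2 - 9 / (y - 4)) _ p
      (hasDerivAt_psi (p 0) (hx4 p hp))).hasFDerivWithinAt
  have hdet : ∀ p, (Φ' p).det = (-1 / 2 + 9 / (p 0 - 4) ^ 2) := fun p => det_smul_id_fin_one _
  refine ⟨1, r'.restrict T hT hTσ, s, Φ, Φ', hΦsa, hderiv, hinj, hsd.trans himg.symm,
    fun p hp => ?_, rfl⟩
  have hp' : p ∈ r'.domain := hTσ hp
  obtain ⟨hfpos, hlt4⟩ := hmemσ p hp
  have hΦp : Φ p ∈ r.domain := himg ▸ mem_image_of_mem Φ hp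
  have hΦp' : Φ p ∈ {p : Fin 1 → ℝ | 4 * p 0 ^ 3 - 120 * p 0 + 224 < 0 ∧ 0 < p 0} := hd ▸ hΦp
  rw [KZ.IntegralRep.integrand_restrict, hi' (hd' ▸ hp' :), hsi, hdet p]
  show 1 / (Real.sqrt 2 * Real.sqrt (4 * p 0 ^ 3 - 120 * p 0 + 224)) =
    r.integrand (Φ p) / 2 * |(-1 / 2 + 9 / (p 0 - 4) ^ 2 : ℝ)|
  rw [hi hΦp']
  exact weight (p 0) hfpos (hx4 p hp) (h18 p hp)

/-! ### Injectivity and image of `Φ` on the two halves (from the real statements) -/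

/-- `Φ` is injective on the typed left half. [folklore] -/
theorem phi_injOn_left :
    InjOn (fun p : Fin 1 → ℝ => fun _ : Fin 1 => -(p 0) / 2 - 9 / (p 0 - 4))
      ({p : Fin 1 → ℝ | 0 < 4 * p 0 ^ 3 - 120 * p 0 + 224 ∧ p 0 < 4} ∩
        {p | 18 < (p 0 - 4) ^ 2}) := by
  intro p hp q hq h
  have h0 : -(p 0) / 2 - 9 / (p 0 - 4) = -(q 0) / 2 - 9 / (q 0 - 4) := congrFun h 0
  have := psi_injOn_left (bounds_left _ hp.1 hp.2) (bounds_left _ hq.1 hq.2) h0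
  funext i
  rw [Fin.fin_one_eq_zero i]
  exact this

/-- `Φ` is injective on the typed right half. [folklore] -/
theorem phi_injOn_right :
    InjOn (fun p : Fin 1 → ℝ => fun _ : Fin 1 => -(p 0) / 2 - 9 / (p 0 - 4))
      ({p : Fin 1 → ℝ | 0 < 4 * p 0 ^ 3 - 120 * p 0 + 224 ∧ p 0 < 4} ∩
        {p | (p 0 - 4) ^ 2 < 18}) := by
  intro p hp q hq h
  have h0 : -(p 0) / 2 - 9 / (p 0 - 4) = -(q 0) / 2 - 9 / (q 0 - 4) := congrFun h 0
  have := psi_injOn_right (bounds_right _ hp.1 hp.2) (bounds_right _ hq.1 hq.2) h0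
  funext i
  rw [Fin.fin_one_eq_zero i]
  exact this

/-- `Φ` maps the typed left half onto the typed twisted oval. [folklore] -/
theorem phi_image_left :
    (fun p : Fin 1 → ℝ => fun _ : Fin 1 => -(p 0) / 2 - 9 / (p 0 - 4)) ''
      ({p : Fin 1 → ℝ | 0 < 4 * p 0 ^ 3 - 120 * p 0 + 224 ∧ p 0 < 4} ∩
        {p | 18 < (p 0 - 4) ^ 2}) =
      {p | 4 * p 0 ^ 3 - 120 * p 0 + 224 < 0 ∧ 0 < p 0} := by
  ext q
  constructor
  · rintro ⟨p, hp, rfl⟩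
    exact psi_mem_sigma' (p 0) hp.1.1 hp.1.2 (ne_of_gt hp.2)
  · intro hq
    have hy := (mem_sigma'_iff (q 0)).1 hq
    obtain ⟨x, hx, hxy⟩ := psi_surjOn_left hy
    refine ⟨fun _ => x, ?_, ?_⟩
    · exact mem_left x hx
    · funext i
      rw [Fin.fin_one_eq_zero i]
      exact hxy

/-- `Φ` maps the typed right half onto the typed twisted oval. [folklore] -/
theorem phi_image_right :
    (fun p : Fin 1 → ℝ => fun _ : Fin 1 => -(p 0) / 2 - 9 / (p 0 - 4)) ''
      ({p : Fin 1 → ℝ | 0 < 4 * p 0 ^ 3 - 120 * p 0 + 224 ∧ p 0 < 4} ∩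
        {p | (p 0 - 4) ^ 2 < 18}) =
      {p | 4 * p 0 ^ 3 - 120 * p 0 + 224 < 0 ∧ 0 < p 0} := by
  ext q
  constructor
  · rintro ⟨p, hp, rfl⟩
    exact psi_mem_sigma' (p 0) hp.1.1 hp.1.2 (ne_of_lt hp.2)
  · intro hq
    have hy := (mem_sigma'_iff (q 0)).1 hq
    obtain ⟨x, hx, hxy⟩ := psi_surjOn_right hy
    refine ⟨fun _ => x, ?_, ?_⟩
    · exact mem_right x hx
    · funext i
      rw [Fin.fin_one_eq_zero i]
      exact hxy

/-! ### The transfer -/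

/-- **CM period transfer as moves** (explicit form): for `r = [σ', 1/√(−f)]` and
`r' = [σ, 1/(√2√f)]` on `y² = 4x³ − 120x + 224`, `KZ.Equivalent r r'` — two rule-(1a) splits at
the fold point, the null point representation, two rule-(2) moves along `Ψ`, one rule-(1b) move.
[cite: KontsevichZagier2001, §1.2 rules (1), (2)] -/
theorem transfer (r r' : KZ.IntegralRep 1)
    (hd : r.domain = {p | 4 * p 0 ^ 3 - 120 * p 0 + 224 < 0 ∧ 0 < p 0})
    (hi : EqOn r.integrand (fun p => 1 / Real.sqrt (-(4 * p 0 ^ 3 - 120 * p 0 + 224)))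
      {p | 4 * p 0 ^ 3 - 120 * p 0 + 224 < 0 ∧ 0 < p 0})
    (hd' : r'.domain = {p | 0 < 4 * p 0 ^ 3 - 120 * p 0 + 224 ∧ p 0 < 4})
    (hi' : EqOn r'.integrand
      (fun p => 1 / (Real.sqrt 2 * Real.sqrt (4 * p 0 ^ 3 - 120 * p 0 + 224)))
      {p | 0 < 4 * p 0 ^ 3 - 120 * p 0 + 224 ∧ p 0 < 4}) :
    KZ.Equivalent r r' := by
  set S : Set (Fin 1 → ℝ) := {p | 0 < 4 * p 0 ^ 3 - 120 * p 0 + 224 ∧ p 0 < 4} with hS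
  have hSsa : IsSemialgebraic ℚ S := hd' ▸ r'.isSemialgebraic_domain
  -- the pieces
  have hA : IsSemialgebraic ℚ (S ∩ {p | 18 < (p 0 - 4) ^ 2}) := hSsa.inter isSemialgebraic_setOf_lt_sq
  have hP : IsSemialgebraic ℚ (S ∩ {p | (p 0 - 4) ^ 2 = 18}) := hSsa.inter isSemialgebraic_setOf_sq_eq
  have hB : IsSemialgebraic ℚ (S ∩ {p | (p 0 - 4) ^ 2 < 18}) := hSsa.inter isSemialgebraic_setOf_sq_lt
  have hAP : IsSemialgebraic ℚ (S ∩ {p | 18 ≤ (p 0 - 4) ^ 2}) :=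
    hSsa.inter isSemialgebraic_setOf_le_sq
  have hsub : ∀ U : Set (Fin 1 → ℝ), S ∩ U ⊆ r'.domain := fun U => hd' ▸ inter_subset_left
  set rA := r'.restrict _ hA (hsub _) with hrA
  set rP := r'.restrict _ hP (hsub _) with hrP
  set rB := r'.restrict _ hB (hsub _) with hrB
  set rAP := r'.restrict _ hAP (hsub _) with hrAP
  obtain ⟨s, hsd, hsi, hhalf⟩ := exists_half r
  -- move 1 (rule 1a): [σ] = [σ ∩ {18 ≤ (x-4)²}] + [σ ∩ {(x-4)² < 18}]
  have m1 : KZ.of r' - KZ.of rAP - KZ.of rB ∈ KZ.domainAddRel := by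
    refine ⟨1, r', rAP, rB, ?_, ?_, fun _ _ => rfl, fun _ _ => rfl, rfl⟩
    · show r'.domain = S ∩ {p | 18 ≤ (p 0 - 4) ^ 2} ∪ S ∩ {p | (p 0 - 4) ^ 2 < 18}
      rw [← inter_union_distrib_left, hd']
      refine (inter_eq_left.mpr fun p _ => ?_).symm
      exact (le_or_gt 18 ((p 0 - 4) ^ 2)).imp id id
    · show volume (S ∩ {p | 18 ≤ (p 0 - 4) ^ 2} ∩ (S ∩ {p | (p 0 - 4) ^ 2 < 18})) = 0
      have he : S ∩ {p | 18 ≤ (p 0 - 4) ^ 2} ∩ (S ∩ {p | (p 0 - 4) ^ 2 < 18}) = ∅ := by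
        refine eq_empty_of_forall_notMem fun p hp => ?_
        have h1 : 18 ≤ (p 0 - 4) ^ 2 := hp.1.2
        have h2 : (p 0 - 4) ^ 2 < 18 := hp.2.2
        exact (not_lt.mpr h1) h2
      rw [he, measure_empty]
  -- move 2 (rule 1a): [σ ∩ {18 ≤ (x-4)²}] = [σ ∩ {18 < (x-4)²}] + [σ ∩ {(x-4)² = 18}]
  have m2 : KZ.of rAP - KZ.of rA - KZ.of rP ∈ KZ.domainAddRel := by
    refine ⟨1, rAP, rA, rP, ?_, ?_, fun _ _ => rfl, fun _ _ => rfl, rfl⟩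
    · show S ∩ {p | 18 ≤ (p 0 - 4) ^ 2} = S ∩ {p | 18 < (p 0 - 4) ^ 2} ∪ S ∩ {p | (p 0 - 4) ^ 2 = 18}
      rw [← inter_union_distrib_left]
      congr 1
      ext p
      simp only [mem_setOf_eq, mem_union]
      constructor
      · intro h
        rcases h.lt_or_eq with h | h
        · exact Or.inl h
        · exact Or.inr h.symm
      · rintro (h | h)
        · exact h.le
        · exact h.ge
    · show volume (S ∩ {p | 18 < (p 0 - 4) ^ 2} ∩ (S ∩ {p | (p 0 - 4) ^ 2 = 18})) = 0
      exact measure_mono_null (fun p hp => hp.2.2) volume_setOf_sq_eq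
  -- move 3: the fold-point representation is a relation (null domain)
  have m3 : KZ.of rP ∈ KZ.relations :=
    KZ.of_mem_relations_of_volume_eq_zero rP
      (measure_mono_null (fun p hp => hp.2) volume_setOf_sq_eq)
  -- moves 4, 5 (rule 2 along Ψ on each half)
  have m4 : KZ.of rA - KZ.of s ∈ KZ.changeOfVariablesRel :=
    piece_cov r r' s hd hi hd' hi' hsd hsi hA (hsub _) (fun p hp => ne_of_gt hp.2)
      phi_injOn_left (phi_image_left.trans hd.symm)
  have m5 : KZ.of rB - KZ.of s ∈ KZ.changeOfVariablesRel :=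
    piece_cov r r' s hd hi hd' hi' hsd hsi hB (hsub _) (fun p hp => ne_of_lt hp.2)
      phi_injOn_right (phi_image_right.trans hd.symm)
  -- compose
  have h1 := KZ.domainAddRel_subset_relations m1
  have h2 := KZ.domainAddRel_subset_relations m2
  have h4 := KZ.changeOfVariablesRel_subset_relations m4
  have h5 := KZ.changeOfVariablesRel_subset_relations m5
  have h6 := KZ.integrandAddRel_subset_relations hhalf
  show KZ.of r - KZ.of r' ∈ KZ.relations
  have : KZ.of r - KZ.of r' = (KZ.of r - KZ.of s - KZ.of s) - (KZ.of r' - KZ.of rAP - KZ.of rB) -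
      (KZ.of rAP - KZ.of rA - KZ.of rP) - KZ.of rP - (KZ.of rA - KZ.of s) - (KZ.of rB - KZ.of s) := by
    abel
  rw [this]
  exact KZ.relations.sub_mem (KZ.relations.sub_mem (KZ.relations.sub_mem
    (KZ.relations.sub_mem (KZ.relations.sub_mem h6 h1) h2) m3) h4) h5

/-- **`CMTwistPeriodTransfer`** (stmt-KontsevichZagierPeriods-3415): on `y² = 4x³ − 120x + 224`
(`j = 8000`), any representations `r = [σ', 1/√(−f)]` (`σ' = {f < 0 ∧ 0 < x} = (e₂, 4)`) and
`r' = [σ, 1/(√2√f)]` (`σ = {0 < f ∧ x < 4} = (e₃, e₂)`) are `KZ.Equivalent`: the CM period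
relation `|ω₂| = ω₁/√2` is derivable by Kontsevich–Zagier's rules (1), (2) along the real
`x`-coordinate of `[√−2]`. [cite: KontsevichZagier2001, §1.2 rules (1), (2)] -/
theorem CMTwistPeriodTransfer_proof :
    Summit.KontsevichZagierPeriods.KontsevichZagierPeriods.Theses.HermiteRigidity.CMTwistPeriodTransfer := by
  unfold Summit.KontsevichZagierPeriods.KontsevichZagierPeriods.Theses.HermiteRigidity.CMTwistPeriodTransfer
  intro f σ σ' r r' hd hi hd' hi'
  exact transfer r r' hd hi hd' hi'

end Summit.KontsevichZagierPeriods.HermiteRigidity.CMTwistPeriodTransfer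

end
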